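import Summits.CriticalPhenomena.PercolationContinuityZ3.Theorems.PercExchangeRateTransportModelFacts

/-!
# Witness of weakness (F3 / BC5) for the rung family `ExchangeRateLowerBound κ`

`ExchangeRateLowerBound (-1)` IS the floor: it follows from the seed theorem
`ModelFacts.modelFacts_proof` (item stmt-CriticalPhenomena-16064) alone — clause (8)
(`0 < ∂_pΘ_n` on the open square, `n ≥ 1`) and clause (4) (`Θ_n` monotone in `t`, whence
`0 ≤ ∂_tΘ_n`) — with the witness constant `c = 0 > -1`. The rung is `κ = 0` (`c > 0`), which the
seed proof cannot give: its clause (8) keeps ONE pivotal cylinder whose weight decays exponentially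
in `n` (stub_pivotalPos), so no `n`-uniform ratio bound comes out of it.
Self-contained copy of the family (verbatim the `def` of `Lines/exchange_comparability.lean`).
-/

namespace Summit.CriticalPhenomena.PercolationContinuityZ3.Cruxes.SubcritExchangeUniformity.ExchangeComparability.Special

/-- Verbatim copy of `ExchangeComparability.ExchangeRateLowerBound` (self-contained witness file). -/
def ExchangeRateLowerBound (κ : ℝ) : Prop :=
  let μ := Literature.Probability.Percolation.labelMeasure (Literature.Probability.LatticeModels.Site 3)
  let vert : Sym2 (Literature.Probability.LatticeModels.Site 3) → Prop :=
    fun e => ∃ x : Literature.Probability.LatticeModels.Site 3, e = s(x, x + Pi.single (2 : Fin 3) 1)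
  let cfg : ℝ → ℝ → (Sym2 (Literature.Probability.LatticeModels.Site 3) → ℝ) →
      Set (Sym2 (Literature.Probability.LatticeModels.Site 3)) :=
    fun p t U => {e | e ∈ (Literature.Probability.LatticeModels.zdGraph 3).edgeSet ∧
      ((vert e ∧ U e ≤ t) ∨ (¬ vert e ∧ U e ≤ p))}
  let Θ : ℕ → ℝ → ℝ → ℝ :=
    fun n p t => μ.real {U | cfg p t U ∈ Literature.Probability.Percolation.siteToBoundary 3 n}
  ∀ lo hi : ℝ, 0 < lo → lo < hi → hi < 1 → ∃ c : ℝ, κ < c ∧ ∀ n : ℕ, 1 ≤ n →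
    ∀ p ∈ Set.Icc lo hi, ∀ t ∈ Set.Icc lo hi,
      0 < deriv (fun q => Θ n q t) p ∧ c * deriv (fun q => Θ n q t) p ≤ deriv (fun s => Θ n p s) t

/-- **F3 witness: the floor is the `κ = -1` instance of the family.** Specialising the parameter
to `κ := -1` gives a statement proved in a few lines from the seed `modelFacts_proof`
(clauses (4) and (8)), with `c := 0`. -/
theorem exchangeRateLowerBound_floor : ExchangeRateLowerBound (-1) := by
  obtain ⟨-, -, -, h4, -, -, -, h8, -, -⟩ :=
    Summit.CriticalPhenomena.PercolationContinuityZ3.Theorems.ModelFacts.modelFacts_proof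
  intro lo hi hlo _ hhi
  refine ⟨0, by norm_num, fun n hn p hp t ht => ?_⟩
  have hp' : p ∈ Set.Ioo (0 : ℝ) 1 := ⟨hlo.trans_le hp.1, hp.2.trans_lt hhi⟩
  have ht' : t ∈ Set.Ioo (0 : ℝ) 1 := ⟨hlo.trans_le ht.1, ht.2.trans_lt hhi⟩
  refine ⟨h8 n hn p hp' t ht', ?_⟩
  rw [zero_mul]
  exact (h4 n p).deriv_nonneg

end Summit.CriticalPhenomena.PercolationContinuityZ3.Cruxes.SubcritExchangeUniformity.ExchangeComparability.Special
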